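import Summits.BirchSwinnertonDyer.Rank1Residual.P2.CMKolyvaginHabitatTwentySevenA4
import Summits.BirchSwinnertonDyer.Rank1Residual.P2.CMKolyvaginHabitatManinAtTwo
import Summits.BirchSwinnertonDyer.BirchSwinnertonDyer.Theorems.GoldfeldGoodTwistsLocalTwo
import Literature.NumberTheory.EllipticCurves.QuadraticTwistLocalDataAtTwoHoldsProofs
import Literature.NumberTheory.EllipticCurves.OrdinaryPrimesProofs
import HarnessLib

/-!
# Route `CMKolyvaginAtInertTwo` (leaf `WAllCornerFTwo`): the `j = −12288000` class at the prime `2` —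
# good reduction at `2 ⟺ d ≡ 1 (mod 4)`, the Manin binder, and the habitat `H₂` assembled

Cell `bsd-print-cf2`, seat ty2 (discharge interface), line `route-BirchSwinnertonDyer-CMKolyvaginAtInertTwo`
(items stmt-BirchSwinnertonDyer-24276/24277, residual 22838). HONEST FRAMING: THEOREMS ONLY — no
definition, no named fact, no route file imported, nothing about BSD asserted or booked; the leaf is OPEN.

`CMKolyvaginHabitatTwentySevenA4` decided the Tamagawa / image / CM-inert binders of `H₂` on the
square-free twists `27a4^{(d)}` (`27a4 = (0,0,1,−30,63)`, `Δ = −3⁵`, good at `2`). This file adds the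
prime `2`, for EVERY globally minimal model `W'` of `27a4^{(d)}`, `d` square-free:

* `hasGoodReductionAtPrime_two_curve27a4` — `27a4` is good at `2` (`2 ∤ Δ_min = −243`);
* `hasGoodReductionAtPrime_two_twist_iff` — **`W'` good at `2 ⟺ d ≡ 1 (mod 4)`**: `⟸` the twisting
  character is unramified at `2` (tree theorem
  `hasGoodReductionAtPrime_and_frobeniusTrace_of_smul_eq_quadraticTwist_two`, Silverman VII.5.1(a));
  `⟹` for `d ≡ 2, 3 (mod 4)` the twist of a good curve over `ℚ₂` is of type `I₈*`/`II` resp.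
  `I₄*`/`II*`, never `I₀` (Barrios et al. 2025 Thm. 5.1 rows `R = I₀`, the tree's discharged fact
  `BarriosEtAl2025_quadraticTwist_two_of_goodReduction_holds`);
* `maninBinder_twist` — on the slice `d ≡ 1 (mod 4)`, "`W'` optimal" gives the habitat's Manin binder
  `∃ Dt, Λ_E ⊆ c·Λ_f ∧ Odd c`, modulo Abbes–Ullmo (`hAU`);
* `habitat_twist` / `habitat_twist_of_maninBinder` — the literal `H₂` block of the route's items
  between `W.HasCM` and `W.analyticRank = 1`, for silent `d` (and `d ≡ 1 (mod 4)` + optimal, resp. the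
  Manin binder as a hypothesis).

References: Barrios–Roy–Sahajpal–Tallana–Tobin–Wiersema 2025 Thm. 5.1 [BarriosEtAl2025]; Silverman *AEC*
VII.5 Prop. 5.1(a) [SilvermanAEC2009]; Abbes–Ullmo 1996 Thm. A [AbbesUllmo1996]; Boxer–Diao 2010 proof
of Prop. 4.1 [BoxerDiao2010]; Cremona's tables (label 27a4) [Cremona2006].
-/

set_option autoImplicit false

noncomputable section

open scoped Classical NumberField

open WeierstrassCurve NumberField Literature.NumberTheory.EllipticCurves
  Literature.NumberTheory.EllipticCurves.ModularForms Literature.NumberTheory.EllipticCurves.Rank1Residual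
  Summit.BirchSwinnertonDyer.BirchSwinnertonDyer.Theorems.GoldfeldGoodTwists

namespace Summit.BirchSwinnertonDyer.Rank1Residual.P2.TwentySevenA4

/-! ## §1 `27a4` at `2` -/

/-- **`27a4` has good reduction at `2`** (`Δ_min = −243` is odd). [cite: Cremona2006, §2 (label 27a4)]
[cite: SilvermanAEC2009, VII.1 Remark 1.1] -/
theorem hasGoodReductionAtPrime_two_curve27a4 :
    (haveI := isGloballyMinimal_curve27a4
     (⟨0, 0, 1, -30, 63⟩ : WeierstrassCurve ℚ).HasGoodReductionAtPrime 2) := by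
  haveI := isGloballyMinimal_curve27a4
  haveI : Fact (Nat.Prime 2) := ⟨Nat.prime_two⟩
  refine hasGoodReductionAtPrime_of_not_dvd _ 2 ?_
  rw [minimalDiscriminantInt, integralModelInt_curve27a4, Δ_curve27a4_int]
  decide

/-! ## §2 Good reduction at `2` of the twists: exactly `d ≡ 1 (mod 4)` -/

section Two

variable (W' : WeierstrassCurve ℚ) [W'.IsElliptic] {C : VariableChange ℚ} {d : ℤ}

omit [W'.IsElliptic] in
/-- **`d ≡ 1 (mod 4)` ⟹ every globally minimal model of `27a4^{(d)}` is good at `2`** (twisting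
character unramified at `2`). [cite: SilvermanAEC2009, VII.5 Prop. 5.1(a) and X.5 Cor. 5.4.1] -/
theorem hasGoodReductionAtPrime_two_twist_of_emod_four_eq_one [W'.IsGloballyMinimal] (hd4 : d % 4 = 1)
    (hC : C • W' = (⟨0, 0, 1, -30, 63⟩ : WeierstrassCurve ℚ).quadraticTwist (d : ℚ)) :
    W'.HasGoodReductionAtPrime 2 := by
  haveI := isElliptic_curve27a4
  haveI := isGloballyMinimal_curve27a4
  haveI : Fact (Nat.Prime 2) := ⟨Nat.prime_two⟩
  exact (hasGoodReductionAtPrime_and_frobeniusTrace_of_smul_eq_quadraticTwist_two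
    (⟨0, 0, 1, -30, 63⟩ : WeierstrassCurve ℚ) W' hd4 hC 2 rfl hasGoodReductionAtPrime_two_curve27a4).1

/-- **`d ≡ 2, 3 (mod 4)` ⟹ no model of `27a4^{(d)}` is good at `2`**: over `ℚ₂` the twist of the good
curve `27a4` has Kodaira symbol `I₈*` or `II` (`d ≡ 2`), `I₄*` or `II*` (`d ≡ 3 (mod 4)`), while good
reduction means `I₀`; the symbol is a `ℚ₂`-isomorphism invariant.
[cite: BarriosEtAl2025, Thm. 5.1 with the rows R = I₀ of the §5 tables (arXiv:2501.03209 pp. 15–16)]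
[cite: SilvermanATAEC1994, IV.9.4 (Tate's algorithm, Step 1)] -/
theorem not_hasGoodReductionAtPrime_two_twist_of_emod_four (hd : d % 4 = 2 ∨ d % 4 = 3)
    (hC : C • W' = (⟨0, 0, 1, -30, 63⟩ : WeierstrassCurve ℚ).quadraticTwist (d : ℚ)) :
    ¬ W'.HasGoodReductionAtPrime 2 := by
  haveI := isElliptic_curve27a4
  haveI := isGloballyMinimal_curve27a4
  intro hgood
  haveI := TwistGoodTwo.perfectField_residueField_padicInt
  set E : WeierstrassCurve ℚ := ⟨0, 0, 1, -30, 63⟩ with hE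
  have hB := BarriosEtAl2025_quadraticTwist_two_of_goodReduction_holds (E.baseChange ℚ_[2])
    hasGoodReductionAtPrime_two_curve27a4 d
  have hbc : (C.map (algebraMap ℚ ℚ_[2])) • W'.baseChange ℚ_[2] =
      (E.baseChange ℚ_[2]).quadraticTwist (d : ℚ_[2]) := by
    simp only [WeierstrassCurve.baseChange]
    rw [map_variableChange, hC, map_quadraticTwist, map_intCast]
  have hI0 : (W'.baseChange ℚ_[2]).kodairaSymbol ℤ_[2] = .I 0 := by
    haveI : ((W'.baseChange ℚ_[2]).minimal ℤ_[2]).HasGoodReduction ℤ_[2] := hgood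
    unfold WeierstrassCurve.kodairaSymbol
    exact TwistGoodTwo.kodairaSymbolOfMinimal_eq_I_zero_of_isUnit_Δ _
      (TwistGoodTwo.isUnit_Δ_integralModel_of_hasGoodReduction _)
  have hK : ((E.baseChange ℚ_[2]).quadraticTwist (d : ℚ_[2])).kodairaSymbol ℤ_[2] = .I 0 := by
    rw [← hbc, kodairaSymbol_smul_holds ℤ_[2] (W'.baseChange ℚ_[2]), hI0]
  rcases hd with h2 | h3
  · obtain ⟨h, -⟩ := hB.2.2 (by unfold Int.ModEq; omega)
    rw [hK] at h
    rcases h with h | h <;> exact absurd h (by decide)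
  · obtain ⟨h, -⟩ := hB.2.1 (by unfold Int.ModEq; omega)
    rw [hK] at h
    rcases h with h | h <;> exact absurd h (by decide)

/-- **Good reduction at `2` on the `j = −12288000` class, decided:** for `d` square-free and every
globally minimal model `W'` of `27a4^{(d)}`, `W'` is good at `2 ⟺ d ≡ 1 (mod 4)`.
[cite: BarriosEtAl2025, Thm. 5.1 (rows R = I₀)] [cite: SilvermanAEC2009, VII.5 Prop. 5.1(a)] -/
theorem hasGoodReductionAtPrime_two_twist_iff [W'.IsGloballyMinimal] (hsq : Squarefree d)
    (hC : C • W' = (⟨0, 0, 1, -30, 63⟩ : WeierstrassCurve ℚ).quadraticTwist (d : ℚ)) :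
    W'.HasGoodReductionAtPrime 2 ↔ d % 4 = 1 := by
  refine ⟨fun hgood => ?_, fun hd4 => hasGoodReductionAtPrime_two_twist_of_emod_four_eq_one W' hd4 hC⟩
  by_contra hd4
  have hd0 : d % 4 ≠ 0 := by
    intro h0
    have h4 : (2 : ℤ) * 2 ∣ d := by omega
    have h2u : IsUnit (2 : ℤ) := hsq 2 h4
    exact absurd (Int.isUnit_iff.mp h2u) (by omega)
  exact not_hasGoodReductionAtPrime_two_twist_of_emod_four W' (by omega) hC hgood

/-- **`2 ∣ N(W') ⟺ d ≢ 1 (mod 4)`** on the class (conductor form of the previous theorem).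
[cite: BarriosEtAl2025, Thm. 5.1 (rows R = I₀)] [cite: SilvermanAEC2009, VII.5 Prop. 5.1(a)] -/
theorem two_dvd_conductorNorm_twist_iff [W'.IsGloballyMinimal] (hsq : Squarefree d)
    (hC : C • W' = (⟨0, 0, 1, -30, 63⟩ : WeierstrassCurve ℚ).quadraticTwist (d : ℚ)) :
    2 ∣ W'.conductorNorm ℤ ↔ d % 4 ≠ 1 := by
  haveI : Fact (Nat.Prime 2) := ⟨Nat.prime_two⟩
  rw [W'.dvd_conductorNorm_iff_not_hasGoodReductionAtPrime 2, hasGoodReductionAtPrime_two_twist_iff W' hsq hC]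

end Two

/-! ## §3 The Manin binder and the habitat `H₂` on the `j = −12288000` class -/

section Habitat

variable (W' : WeierstrassCurve ℚ) [W'.IsElliptic] {C : VariableChange ℚ} {d : ℤ}

/-- **The habitat's MANIN binder on the good-at-2 slice of the class:** for a globally minimal model
`W'` of `27a4^{(d)}` with `d ≡ 1 (mod 4)`, "`W'` optimal" gives `∃ Dt, Λ_E ⊆ c·Λ_f ∧ Odd c`, modulo
Abbes–Ullmo. [cite: AbbesUllmo1996, Thm. A] -/
theorem maninBinder_twist [W'.IsGloballyMinimal] [NeZero (W'.conductorNorm ℤ)]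
    (hAU : abbesUllmo_not_dvd_maninConstant_of_not_dvd_level) (hd4 : d % 4 = 1)
    (hC : C • W' = (⟨0, 0, 1, -30, 63⟩ : WeierstrassCurve ℚ).quadraticTwist (d : ℚ))
    (hopt : ∃ Dt : ModularParametrizationData W' (W'.conductorNorm ℤ), ShuZhai2021.IsOptimalDatum W' Dt) :
    ∃ Dt : ModularParametrizationData W' (W'.conductorNorm ℤ),
      (∀ z ∈ Dt.L.lattice, ∃ w ∈ periodLattice Dt.f, z = (Dt.c : ℂ) * w) ∧ Odd Dt.c :=
  maninBinder_of_exists_isOptimalDatum_of_hasGoodReductionAtPrime_two W' hAU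
    (hasGoodReductionAtPrime_two_twist_of_emod_four_eq_one W' hd4 hC) hopt

/-- **The `j = −12288000` class in `H₂`, good-at-2 members:** a globally minimal, optimal model `W'` of
`27a4^{(d)}` with `d` square-free, `d ≡ 1 (mod 4)` and `d` SILENT (no root of `4x³ − 120x + 253` mod any
prime `p ≥ 5` dividing `d`) satisfies the literal arithmetic block of `H₂`:
`HasCM ∧ CMInert 2 ∧ ρ̄₂ onto ∧ Odd ∏c ∧ (∃ Dt, Λ_E ⊆ cΛ_f ∧ Odd c)`, modulo Abbes–Ullmo.
[cite: BoxerDiao2010, proof of Prop. 4.1 (pp. 1976–1977)] [cite: DokchitserDokchitserMathZ2012, Theorem (1)]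
[cite: AbbesUllmo1996, Thm. A] -/
theorem habitat_twist [W'.IsGloballyMinimal] [NeZero (W'.conductorNorm ℤ)]
    (hAU : abbesUllmo_not_dvd_maninConstant_of_not_dvd_level) (hsq : Squarefree d) (hd4 : d % 4 = 1)
    (hC : C • W' = (⟨0, 0, 1, -30, 63⟩ : WeierstrassCurve ℚ).quadraticTwist (d : ℚ))
    (hsil : ∀ p : ℕ, p.Prime → 5 ≤ p → (p : ℤ) ∣ d → ∀ x : ZMod p, 4 * x ^ 3 - 120 * x + 253 ≠ 0)
    (hopt : ∃ Dt : ModularParametrizationData W' (W'.conductorNorm ℤ), ShuZhai2021.IsOptimalDatum W' Dt) :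
    W'.HasCM ∧ (CMInert W' 2 ∧ W'.HasSurjectiveModNGaloisRep (2 : ℤ) ∧ Odd W'.tamagawaProduct ∧
      ∃ Dt : ModularParametrizationData W' (W'.conductorNorm ℤ),
        (∀ z ∈ Dt.L.lattice, ∃ w ∈ periodLattice Dt.f, z = (Dt.c : ℂ) * w) ∧ Odd Dt.c) := by
  obtain ⟨hCM, hin, hs, ht⟩ := (arithmeticHabitat_twist_iff W' hsq.ne_zero hsq hC).mpr hsil
  exact ⟨hCM, hin, hs, ht, maninBinder_twist W' hAU hd4 hC hopt⟩

/-- **The `j = −12288000` class in `H₂`, any member:** same as `habitat_twist` with the Manin binder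
kept as a hypothesis (no Abbes–Ullmo off the good-at-2 slice `d ≡ 1 (mod 4)`).
[cite: BoxerDiao2010, proof of Prop. 4.1 (pp. 1976–1977)] [cite: DokchitserDokchitserMathZ2012, Theorem (1)] -/
theorem habitat_twist_of_maninBinder [NeZero (W'.conductorNorm ℤ)] (hsq : Squarefree d)
    (hC : C • W' = (⟨0, 0, 1, -30, 63⟩ : WeierstrassCurve ℚ).quadraticTwist (d : ℚ))
    (hsil : ∀ p : ℕ, p.Prime → 5 ≤ p → (p : ℤ) ∣ d → ∀ x : ZMod p, 4 * x ^ 3 - 120 * x + 253 ≠ 0)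
    (hM : ∃ Dt : ModularParametrizationData W' (W'.conductorNorm ℤ),
      (∀ z ∈ Dt.L.lattice, ∃ w ∈ periodLattice Dt.f, z = (Dt.c : ℂ) * w) ∧ Odd Dt.c) :
    W'.HasCM ∧ (CMInert W' 2 ∧ W'.HasSurjectiveModNGaloisRep (2 : ℤ) ∧ Odd W'.tamagawaProduct ∧
      ∃ Dt : ModularParametrizationData W' (W'.conductorNorm ℤ),
        (∀ z ∈ Dt.L.lattice, ∃ w ∈ periodLattice Dt.f, z = (Dt.c : ℂ) * w) ∧ Odd Dt.c) := by
  obtain ⟨hCM, hin, hs, ht⟩ := (arithmeticHabitat_twist_iff W' hsq.ne_zero hsq hC).mpr hsil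
  exact ⟨hCM, hin, hs, ht, hM⟩

/-- **Off the habitat by the Manin slice's level condition:** for `d ≢ 1 (mod 4)` the model is bad at
`2` (`4 ∣ N`), where no printed theorem makes the Manin constant odd — recorded as the conductor
statement `2 ∣ N(W')`; nothing about the Manin constant is claimed. [cite: BarriosEtAl2025, Thm. 5.1 (rows R = I₀)] -/
theorem two_dvd_conductorNorm_twist_of_emod_four_ne_one [W'.IsGloballyMinimal] (hsq : Squarefree d)
    (hd4 : d % 4 ≠ 1) (hC : C • W' = (⟨0, 0, 1, -30, 63⟩ : WeierstrassCurve ℚ).quadraticTwist (d : ℚ)) :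
    2 ∣ W'.conductorNorm ℤ :=
  (two_dvd_conductorNorm_twist_iff W' hsq hC).mpr hd4

end Habitat

end Summit.BirchSwinnertonDyer.Rank1Residual.P2.TwentySevenA4

end
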